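import Mathlib
import Summits.Ventures.PercRepro2.Defs
import Summits.Ventures.PercRepro2.Graph
import Summits.Ventures.PercRepro2.OneColourSwitch
import Summits.Ventures.PercRepro2.RegionHubSign
import Summits.Ventures.PercRepro2.SideSwitch
import Summits.Ventures.PercRepro2.TermSwitchDefs
import Summits.Ventures.PercRepro2.TermSwitchReach
import Summits.Ventures.PercRepro2.M9NoPocketDefs
import Summits.Ventures.PercRepro2.M9GeneralDSplit
import Summits.Ventures.PercRepro2.M9LinkedHD
import Summits.Ventures.PercRepro2.M9HDRSplit
import Summits.Ventures.PercRepro2.M9WorldSwitch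
import Summits.Ventures.PercRepro2.M9WorldSwitchHD
import Summits.Ventures.PercRepro2.M9WorldSwitchLink
import Summits.Ventures.PercRepro2.M9WorldSwitchYLink

/-!
# THEOREM ψ: the hub–dead-end sum is bounded by its uncovered `Y`-only part (blind cell
PercRepro2, p3 g30, 2026-08-28; `proofs/P3-HDR.md` §4)

The switch `ψ ω = flipTouch (linkSet ω) ω` sends every `W`-only `K`-side hub–dead-end colouring
to a `Y`-only one with `σ_pq` not larger (`hdKYOnly_psi`, from `M9WorldSwitchHD` and
`M9WorldSwitchLink`) and is injective on them (`psi_injOn`, from `M9WorldSwitchYLink`).  Hence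
`W0 ≥ Σ_{ψ(W-only)} σ_pq` and **`hdKSum = Y0 − W0 ≤ Σ_{Y-only ∖ ψ(W-only)} σ_pq`**
(`hdKSum_le_uncovered`): the `K`-side hub–dead-end sum of any graph without an `r–s` edge is at
most the `σ_pq`-sum of the `Y`-only points NOT in the image of the switch (the points whose
`Y`-linking components touch `d`, or whose dirty contact runs through those components —
`proofs/P3-HDR.md` §4).  With `dSignSum ≤ 2 · hdKSum` (`M9HDRSplit`) the general single-`d`
statement follows from `Σ_{uncovered} σ_pq ≤ 0`.  Own work; std axioms.
-/

namespace Summit.Ventures.PercRepro2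

namespace NoPocket

open Finset Classical RegionHub OneColourSwitch SideSwitch TermSwitch

variable {V : Type*} {E : Type*}

section Psi

variable (ends : E → Sym2 V) (r s : V)

/-- **The switch `ψ`**: flip every edge touching the linking components of the `W`-world. -/
noncomputable def psi (ω : Config E) : Config E := flipTouch ends (linkSet ends r s ω) ω

variable {ends r s} {p q d : V}

/-- **`ψ` sends `W`-only to `Y`-only, not increasing `σ_pq`.** -/
theorem hdKYOnly_psi (hrs : r ≠ s) (hno : ∀ e, ends e ≠ s(r, s)) {ω : Config E}
    (h : HDKWOnly ends p q r s d ω) :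
    HDKYOnly ends p q r s d (psi ends r s ω) ∧ sigma ends (psi ends r s ω) p q ≤ sigma ends ω p q :=
  hdKYOnly_flipTouch_of_wOnly h linkSet_wClosed (conn_wIn_linkSet hrs hno h.2.2.1)
    (not_conn_wOut_linkSet hrs hno)

/-- **`ψ` is injective on the `W`-only `K`-side hub–dead-end colourings.** -/
theorem psi_injOn (hrs : r ≠ s) (hno : ∀ e, ends e ≠ s(r, s)) {ω₁ ω₂ : Config E}
    (h₁ : HDKWOnly ends p q r s d ω₁) (h₂ : HDKWOnly ends p q r s d ω₂)
    (h : psi ends r s ω₁ = psi ends r s ω₂) : ω₁ = ω₂ :=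
  flipTouch_linkSet_injOn hrs hno h₁.1.2.1 (not_mem_M2_of_HD_K h₁.1 h₁.2.1) h₁.2.2.2
    h₂.1.2.1 (not_mem_M2_of_HD_K h₂.1 h₂.2.1) h₂.2.2.2 h

end Psi

section Sum

variable [Fintype E] [DecidableEq E] {ends : E → Sym2 V} {p q r s d : V}

/-- The `W`-only points as a finset. -/
noncomputable def wOnlySet (ends : E → Sym2 V) (p q r s d : V) : Finset (Config E) :=
  univ.filter (fun ω => HDKWOnly ends p q r s d ω)

/-- The `Y`-only points as a finset. -/
noncomputable def yOnlySet (ends : E → Sym2 V) (p q r s d : V) : Finset (Config E) :=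
  univ.filter (fun ω => HDKYOnly ends p q r s d ω)

/-- `Y0` as a sum over the `Y`-only finset. -/
lemma hdKYOnlySum_eq_sum : hdKYOnlySum ends p q r s d = ∑ ω ∈ yOnlySet ends p q r s d, sigma ends ω p q := by
  unfold hdKYOnlySum yOnlySet
  rw [Finset.sum_filter]

/-- `W0` as a sum over the `W`-only finset. -/
lemma hdKWOnlySum_eq_sum : hdKWOnlySum ends p q r s d = ∑ ω ∈ wOnlySet ends p q r s d, sigma ends ω p q := by
  unfold hdKWOnlySum wOnlySet
  rw [Finset.sum_filter]

/-- **THEOREM ψ (the sum form)**: `hdKSum ≤ Σ_{Y-only ∖ ψ(W-only)} σ_pq` on every graph without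
an `r–s` edge. -/
theorem hdKSum_le_uncovered (hrs : r ≠ s) (hno : ∀ e, ends e ≠ s(r, s)) :
    hdKSum ends p q r s d ≤
      ∑ ω ∈ yOnlySet ends p q r s d \ (wOnlySet ends p q r s d).image (psi ends r s),
        sigma ends ω p q := by
  rw [hdKSum_eq_yOnly_sub_wOnly, hdKYOnlySum_eq_sum, hdKWOnlySum_eq_sum]
  have hinj : ∀ ω₁ ∈ wOnlySet ends p q r s d, ∀ ω₂ ∈ wOnlySet ends p q r s d,
      psi ends r s ω₁ = psi ends r s ω₂ → ω₁ = ω₂ := by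
    intro ω₁ h₁ ω₂ h₂ h
    exact psi_injOn hrs hno (d := d) (p := p) (q := q) (Finset.mem_filter.1 h₁).2
      (Finset.mem_filter.1 h₂).2 h
  have himg : (wOnlySet ends p q r s d).image (psi ends r s) ⊆ yOnlySet ends p q r s d := by
    intro ω' hω'
    obtain ⟨ω, hω, rfl⟩ := Finset.mem_image.1 hω'
    exact Finset.mem_filter.2 ⟨Finset.mem_univ _,
      (hdKYOnly_psi hrs hno (d := d) (p := p) (q := q) (Finset.mem_filter.1 hω).2).1⟩
  have h1 : ∑ ω ∈ (wOnlySet ends p q r s d).image (psi ends r s), sigma ends ω p q ≤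
      ∑ ω ∈ wOnlySet ends p q r s d, sigma ends ω p q := by
    rw [Finset.sum_image hinj]
    exact Finset.sum_le_sum fun ω hω =>
      (hdKYOnly_psi hrs hno (d := d) (p := p) (q := q) (Finset.mem_filter.1 hω).2).2
  have h2 := Finset.sum_sdiff (f := fun ω => sigma ends ω p q) himg
  linarith

end Sum

end NoPocket

end Summit.Ventures.PercRepro2
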